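/-
Copyright: the b2b-balaban T⁴-continuum CRUX team, row NE7b OWNER lineage `t4-ne7b-p1` (gen 145). Project licence.
-/
import Summits.QuantumFields.BalabanUV.T4Continuum.Spine.NE7b.SupFourPointTreeRowSum

/-!
# THE SIXTEEN-TREE TERM AGAINST THE FULL-GRAPH WEIGHT (SCOPING-d17 §D, the tree recipe (iii) at order 4; toolbox for the weighted slot
# letters of `M₄′`).  (526)∕(655): the fourth-cumulant piece of the entry majorant is `C₄·Σ_{16 trees T on {x,y,z,t}} Π_{e∈T} r_e⁻²`; (527) summed
# it with a slot fixed by (488) `tree_sum_row_le` (`≤ 16·S′³`, `S′ = sup Σ r⁻²`).  The weighted class sums it against the full-graph weight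
# `W = Π_{6 pairs} ϑ` of the four indices.  ROUTING (§1): for each spanning tree `T`, every non-tree pair is bounded by the product of `ϑ`
# along its tree path (submultiplicativity), and no tree edge carries more than three paths, so `W ≤ Π_{e∈T} ϑ_e⁴` (`ϑ ≥ 1`) and
#   `(Π_{e∈T} r_e⁻²)·W ≤ Π_{e∈T} (ϑ_e⁴·r_e⁻²)`   pointwise, for all sixteen trees (4 stars: exponents 3,3,3; 12 paths: 3,4,3 — §0);
# hence (§2) the four slot sums of `T16·W` are (488)'s tree sums for the kernel `q = ϑ⁴r⁻²`: `≤ 16·S4³`, `S4 = sup_aΣ_b ϑ_{ab}⁴r_{ab}⁻²` — one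
# geometry letter (needs `r`'s rate above four times `ϑ`'s) (row NE7b, node U5c; (488) `tree_sum_row_le` BY NAME; Mathlib otherwise; [folklore]).

Cell `pub-balaban`, sub-cell `t4`, spine estimate NE7b (`T4WeightBudget.RelWeightBound`; the cell's OWN estimate — NOT PRINTED in
[Bałaban 1983–89], NOT PROVED).  Crux-route work under `Spine/NE7b/` by the row OWNER (`t4-ne7b-p1` gen 145, file (660)) under FREEZE
(0)'s crux-prover clause; NOTHING of Bałaban's is named as a Lean object, valued or asserted; no `T4Continuum/Support` leaf typed; no
`def`, no notation (the sixteen trees WRITTEN OUT as in (526)); zero `sorry`.  Imports (BY NAME): the OWNER's (488) `…SupFourPointTreeRowSum`.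

WHAT IS PROVED ([folklore]): §0 **`route_star`**, **`route_path`** (scalar routing); §1 **`full_weight_tree16_le`** (pointwise routing);
§2 **`weighted_tree16_slot_one∕two∕three∕four`**; §3 toy.

HONEST (what this is NOT).  The tree term only; the two-point and interpolated terms of `M₄′` and the assembled weighted slot letters are the
next files; scalar skeleton ((A3), NC-NE7b-α UNRULED); nothing of Bałaban's asserted.  BY-NAME EFFECT ON THE WALL: NONE.  NE7b NOT PRINTED ∕
NOT PROVED; spine PROVED 0∕9; rung (B)+1 — the programme's measures remain FINITE-torus statements; NOT the mass gap, NOT Clay.  HONEST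
DEPENDENCY: continuum YM on T⁴ ⇐ BetaPertH ∧ nine spine estimates (0∕9 proved); BetaPertH ⇐ (D1) ∧ (D4) ∧ CAP+tail; G-an2-4 gates asym, D1
and NE2∕3∕4.
-/

set_option autoImplicit false

noncomputable section

namespace Summit.QuantumFields.BalabanUV.T4Continuum.NE7b.SupWeightedTreeSixteen

open Finset Real
open scoped BigOperators
open SupFourPointTreeRowSum (tree_sum_row_le)

/-! ## §0. Scalar routing for a star and for a path -/

/-- Star routing: tree edges `a,b,c ≥ 1`, the three non-tree pairs bounded by the products along their two-edge paths; every edge carries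
two paths, so the full weight is at most `a³b³c³ ≤ a⁴b⁴c⁴`. [folklore] -/
theorem route_star {a b c p q s : ℝ} (ha : 1 ≤ a) (hb : 1 ≤ b) (hc : 1 ≤ c) (hq : 0 ≤ q) (hs : 0 ≤ s) (hpb : p ≤ a * b) (hqb : q ≤ a * c)
    (hsb : s ≤ b * c) : a * b * c * p * q * s ≤ a ^ 4 * b ^ 4 * c ^ 4 := by
  have ha0 : 0 ≤ a := zero_le_one.trans ha
  have hb0 : 0 ≤ b := zero_le_one.trans hb
  have hc0 : 0 ≤ c := zero_le_one.trans hc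
  calc a * b * c * p * q * s = (a * b * c) * (p * q * s) := by ring
    _ ≤ (a * b * c) * ((a * b) * (a * c) * (b * c)) :=
        mul_le_mul_of_nonneg_left (mul_le_mul (mul_le_mul hpb hqb hq (mul_nonneg ha0 hb0)) hsb hs
          (mul_nonneg (mul_nonneg ha0 hb0) (mul_nonneg ha0 hc0))) (mul_nonneg (mul_nonneg ha0 hb0) hc0)
    _ = a ^ 3 * b ^ 3 * c ^ 3 := by ring
    _ ≤ a ^ 4 * b ^ 4 * c ^ 4 :=
        mul_le_mul (mul_le_mul (pow_le_pow_right₀ ha (by norm_num)) (pow_le_pow_right₀ hb (by norm_num)) (pow_nonneg hb0 3)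
          (pow_nonneg ha0 4)) (pow_le_pow_right₀ hc (by norm_num)) (pow_nonneg hc0 3) (mul_nonneg (pow_nonneg ha0 4) (pow_nonneg hb0 4))

/-- Path routing: tree edges `a,b,c ≥ 1` along a path, the non-tree pairs bounded along their tree paths (two of length 2, one of length 3);
the middle edge carries three paths, so the full weight is at most `a³b⁴c³ ≤ a⁴b⁴c⁴`. [folklore] -/
theorem route_path {a b c p q s : ℝ} (ha : 1 ≤ a) (hb : 1 ≤ b) (hc : 1 ≤ c) (hq : 0 ≤ q) (hs : 0 ≤ s) (hpb : p ≤ a * b) (hqb : q ≤ b * c)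
    (hsb : s ≤ a * (b * c)) : a * b * c * p * q * s ≤ a ^ 4 * b ^ 4 * c ^ 4 := by
  have ha0 : 0 ≤ a := zero_le_one.trans ha
  have hb0 : 0 ≤ b := zero_le_one.trans hb
  have hc0 : 0 ≤ c := zero_le_one.trans hc
  calc a * b * c * p * q * s = (a * b * c) * (p * q * s) := by ring
    _ ≤ (a * b * c) * ((a * b) * (b * c) * (a * (b * c))) :=
        mul_le_mul_of_nonneg_left (mul_le_mul (mul_le_mul hpb hqb hq (mul_nonneg ha0 hb0)) hsb hs
          (mul_nonneg (mul_nonneg ha0 hb0) (mul_nonneg hb0 hc0))) (mul_nonneg (mul_nonneg ha0 hb0) hc0)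
    _ = a ^ 3 * b ^ 4 * c ^ 3 := by ring
    _ ≤ a ^ 4 * b ^ 4 * c ^ 4 :=
        mul_le_mul (mul_le_mul (pow_le_pow_right₀ ha (by norm_num)) (le_refl (b ^ 4)) (pow_nonneg hb0 4) (pow_nonneg ha0 4))
          (pow_le_pow_right₀ hc (by norm_num)) (pow_nonneg hc0 3) (mul_nonneg (pow_nonneg ha0 4) (pow_nonneg hb0 4))

variable {ι : Type} [Fintype ι]

variable {ϑ r : ι → ι → ℝ} {S4 : ℝ}

/-! ## §1. Routing the full-graph weight onto each tree -/

omit [Fintype ι] in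
set_option maxHeartbeats 800000 in
/-- **THE POINTWISE ROUTING**: `T16(r)·W ≤ T16(ϑ⁴r⁻²)` — for each of the sixteen spanning trees the full-graph weight is at most the fourth
powers of the tree's edge weights. [folklore] -/
theorem full_weight_tree16_le (hϑ1 : ∀ a b, 1 ≤ ϑ a b) (hϑsymm : ∀ a b, ϑ a b = ϑ b a) (hϑmul : ∀ a b c, ϑ a c ≤ ϑ a b * ϑ b c) (x y z t : ι) :
    ((r x y ^ 2)⁻¹ * (r x z ^ 2)⁻¹ * (r x t ^ 2)⁻¹ + (r x y ^ 2)⁻¹ * (r y z ^ 2)⁻¹ * (r y t ^ 2)⁻¹ + (r x z ^ 2)⁻¹ * (r y z ^ 2)⁻¹ * (r z t ^ 2)⁻¹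
        + (r x t ^ 2)⁻¹ * (r y t ^ 2)⁻¹ * (r z t ^ 2)⁻¹ + (r x y ^ 2)⁻¹ * (r y z ^ 2)⁻¹ * (r z t ^ 2)⁻¹ + (r x y ^ 2)⁻¹ * (r y t ^ 2)⁻¹ * (r z t ^
        2)⁻¹ + (r x z ^ 2)⁻¹ * (r y z ^ 2)⁻¹ * (r y t ^ 2)⁻¹ + (r x z ^ 2)⁻¹ * (r y t ^ 2)⁻¹ * (r z t ^ 2)⁻¹ + (r x t ^ 2)⁻¹ * (r y z ^ 2)⁻¹ * (r y
        t ^ 2)⁻¹ + (r x t ^ 2)⁻¹ * (r y z ^ 2)⁻¹ * (r z t ^ 2)⁻¹ + (r x y ^ 2)⁻¹ * (r x z ^ 2)⁻¹ * (r z t ^ 2)⁻¹ + (r x y ^ 2)⁻¹ * (r x t ^ 2)⁻¹ *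
        (r z t ^ 2)⁻¹ + (r x y ^ 2)⁻¹ * (r x z ^ 2)⁻¹ * (r y t ^ 2)⁻¹ + (r x z ^ 2)⁻¹ * (r x t ^ 2)⁻¹ * (r y t ^ 2)⁻¹ + (r x y ^ 2)⁻¹ * (r x t ^
        2)⁻¹ * (r y z ^ 2)⁻¹ + (r x z ^ 2)⁻¹ * (r x t ^ 2)⁻¹ * (r y z ^ 2)⁻¹) * (ϑ x y * ϑ x z * ϑ x t * ϑ y z * ϑ y t * ϑ z t) ≤
      (ϑ x y ^ 4 * (r x y ^ 2)⁻¹) * (ϑ x z ^ 4 * (r x z ^ 2)⁻¹) * (ϑ x t ^ 4 * (r x t ^ 2)⁻¹) + (ϑ x y ^ 4 * (r x y ^ 2)⁻¹) * (ϑ y z ^ 4 * (r y z ^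
        2)⁻¹) * (ϑ y t ^ 4 * (r y t ^ 2)⁻¹) + (ϑ x z ^ 4 * (r x z ^ 2)⁻¹) * (ϑ y z ^ 4 * (r y z ^ 2)⁻¹) * (ϑ z t ^ 4 * (r z t ^ 2)⁻¹) + (ϑ x t ^ 4
        * (r x t ^ 2)⁻¹) * (ϑ y t ^ 4 * (r y t ^ 2)⁻¹) * (ϑ z t ^ 4 * (r z t ^ 2)⁻¹) + (ϑ x y ^ 4 * (r x y ^ 2)⁻¹) * (ϑ y z ^ 4 * (r y z ^ 2)⁻¹) *
        (ϑ z t ^ 4 * (r z t ^ 2)⁻¹) + (ϑ x y ^ 4 * (r x y ^ 2)⁻¹) * (ϑ y t ^ 4 * (r y t ^ 2)⁻¹) * (ϑ z t ^ 4 * (r z t ^ 2)⁻¹) + (ϑ x z ^ 4 * (r x z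
        ^ 2)⁻¹) * (ϑ y z ^ 4 * (r y z ^ 2)⁻¹) * (ϑ y t ^ 4 * (r y t ^ 2)⁻¹) + (ϑ x z ^ 4 * (r x z ^ 2)⁻¹) * (ϑ y t ^ 4 * (r y t ^ 2)⁻¹) * (ϑ z t ^
        4 * (r z t ^ 2)⁻¹) + (ϑ x t ^ 4 * (r x t ^ 2)⁻¹) * (ϑ y z ^ 4 * (r y z ^ 2)⁻¹) * (ϑ y t ^ 4 * (r y t ^ 2)⁻¹) + (ϑ x t ^ 4 * (r x t ^ 2)⁻¹)
        * (ϑ y z ^ 4 * (r y z ^ 2)⁻¹) * (ϑ z t ^ 4 * (r z t ^ 2)⁻¹) + (ϑ x y ^ 4 * (r x y ^ 2)⁻¹) * (ϑ x z ^ 4 * (r x z ^ 2)⁻¹) * (ϑ z t ^ 4 * (r z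
        t ^ 2)⁻¹) + (ϑ x y ^ 4 * (r x y ^ 2)⁻¹) * (ϑ x t ^ 4 * (r x t ^ 2)⁻¹) * (ϑ z t ^ 4 * (r z t ^ 2)⁻¹) + (ϑ x y ^ 4 * (r x y ^ 2)⁻¹) * (ϑ x z
        ^ 4 * (r x z ^ 2)⁻¹) * (ϑ y t ^ 4 * (r y t ^ 2)⁻¹) + (ϑ x z ^ 4 * (r x z ^ 2)⁻¹) * (ϑ x t ^ 4 * (r x t ^ 2)⁻¹) * (ϑ y t ^ 4 * (r y t ^
        2)⁻¹) + (ϑ x y ^ 4 * (r x y ^ 2)⁻¹) * (ϑ x t ^ 4 * (r x t ^ 2)⁻¹) * (ϑ y z ^ 4 * (r y z ^ 2)⁻¹) + (ϑ x z ^ 4 * (r x z ^ 2)⁻¹) * (ϑ x t ^ 4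
        * (r x t ^ 2)⁻¹) * (ϑ y z ^ 4 * (r y z ^ 2)⁻¹) := by
  have hϑ0 : ∀ a b, 0 ≤ ϑ a b := fun a b => zero_le_one.trans (hϑ1 a b)
  have m_yz_x : ϑ y z ≤ ϑ x y * ϑ x z := by have h := hϑmul y x z; rw [hϑsymm y x] at h; exact h
  have m_yt_x : ϑ y t ≤ ϑ x y * ϑ x t := by have h := hϑmul y x t; rw [hϑsymm y x] at h; exact h
  have m_zt_x : ϑ z t ≤ ϑ x z * ϑ x t := by have h := hϑmul z x t; rw [hϑsymm z x] at h; exact h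
  have m_xz_y : ϑ x z ≤ ϑ x y * ϑ y z := hϑmul x y z
  have m_xt_y : ϑ x t ≤ ϑ x y * ϑ y t := hϑmul x y t
  have m_zt_y : ϑ z t ≤ ϑ y z * ϑ y t := by have h := hϑmul z y t; rw [hϑsymm z y] at h; exact h
  have m_xy_z : ϑ x y ≤ ϑ x z * ϑ y z := by have h := hϑmul x z y; rw [hϑsymm z y] at h; exact h
  have m_xt_z : ϑ x t ≤ ϑ x z * ϑ z t := hϑmul x z t
  have m_yt_z : ϑ y t ≤ ϑ y z * ϑ z t := hϑmul y z t
  have m_xy_t : ϑ x y ≤ ϑ x t * ϑ y t := by have h := hϑmul x t y; rw [hϑsymm t y] at h; exact h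
  have m_xz_t : ϑ x z ≤ ϑ x t * ϑ z t := by have h := hϑmul x t z; rw [hϑsymm t z] at h; exact h
  have m_yz_t : ϑ y z ≤ ϑ y t * ϑ z t := by have h := hϑmul y t z; rw [hϑsymm t z] at h; exact h
  have w1 : ϑ x y * ϑ x z * ϑ x t * ϑ y z * ϑ y t * ϑ z t ≤ ϑ x y ^ 4 * ϑ x z ^ 4 * ϑ x t ^ 4 :=
    Eq.trans_le (by ring) (route_star (hϑ1 x y) (hϑ1 x z) (hϑ1 x t) (hϑ0 y t) (hϑ0 z t) m_yz_x m_yt_x m_zt_x)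
  have t1 : (r x y ^ 2)⁻¹ * (r x z ^ 2)⁻¹ * (r x t ^ 2)⁻¹ * (ϑ x y * ϑ x z * ϑ x t * ϑ y z * ϑ y t * ϑ z t) ≤ (ϑ x y ^ 4 * (r x y ^ 2)⁻¹) * (ϑ x z
        ^ 4 * (r x z ^ 2)⁻¹) * (ϑ x t ^ 4 * (r x t ^ 2)⁻¹) :=
    (mul_le_mul_of_nonneg_left w1 (by positivity)).trans_eq (by ring)
  have w2 : ϑ x y * ϑ x z * ϑ x t * ϑ y z * ϑ y t * ϑ z t ≤ ϑ x y ^ 4 * ϑ y z ^ 4 * ϑ y t ^ 4 :=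
    Eq.trans_le (by ring) (route_star (hϑ1 x y) (hϑ1 y z) (hϑ1 y t) (hϑ0 x t) (hϑ0 z t) m_xz_y m_xt_y m_zt_y)
  have t2 : (r x y ^ 2)⁻¹ * (r y z ^ 2)⁻¹ * (r y t ^ 2)⁻¹ * (ϑ x y * ϑ x z * ϑ x t * ϑ y z * ϑ y t * ϑ z t) ≤ (ϑ x y ^ 4 * (r x y ^ 2)⁻¹) * (ϑ y z
        ^ 4 * (r y z ^ 2)⁻¹) * (ϑ y t ^ 4 * (r y t ^ 2)⁻¹) :=
    (mul_le_mul_of_nonneg_left w2 (by positivity)).trans_eq (by ring)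
  have w3 : ϑ x y * ϑ x z * ϑ x t * ϑ y z * ϑ y t * ϑ z t ≤ ϑ x z ^ 4 * ϑ y z ^ 4 * ϑ z t ^ 4 :=
    Eq.trans_le (by ring) (route_star (hϑ1 x z) (hϑ1 y z) (hϑ1 z t) (hϑ0 x t) (hϑ0 y t) m_xy_z m_xt_z m_yt_z)
  have t3 : (r x z ^ 2)⁻¹ * (r y z ^ 2)⁻¹ * (r z t ^ 2)⁻¹ * (ϑ x y * ϑ x z * ϑ x t * ϑ y z * ϑ y t * ϑ z t) ≤ (ϑ x z ^ 4 * (r x z ^ 2)⁻¹) * (ϑ y z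
        ^ 4 * (r y z ^ 2)⁻¹) * (ϑ z t ^ 4 * (r z t ^ 2)⁻¹) :=
    (mul_le_mul_of_nonneg_left w3 (by positivity)).trans_eq (by ring)
  have w4 : ϑ x y * ϑ x z * ϑ x t * ϑ y z * ϑ y t * ϑ z t ≤ ϑ x t ^ 4 * ϑ y t ^ 4 * ϑ z t ^ 4 :=
    Eq.trans_le (by ring) (route_star (hϑ1 x t) (hϑ1 y t) (hϑ1 z t) (hϑ0 x z) (hϑ0 y z) m_xy_t m_xz_t m_yz_t)
  have t4 : (r x t ^ 2)⁻¹ * (r y t ^ 2)⁻¹ * (r z t ^ 2)⁻¹ * (ϑ x y * ϑ x z * ϑ x t * ϑ y z * ϑ y t * ϑ z t) ≤ (ϑ x t ^ 4 * (r x t ^ 2)⁻¹) * (ϑ y t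
        ^ 4 * (r y t ^ 2)⁻¹) * (ϑ z t ^ 4 * (r z t ^ 2)⁻¹) :=
    (mul_le_mul_of_nonneg_left w4 (by positivity)).trans_eq (by ring)
  have w5 : ϑ x y * ϑ x z * ϑ x t * ϑ y z * ϑ y t * ϑ z t ≤ ϑ x y ^ 4 * ϑ y z ^ 4 * ϑ z t ^ 4 :=
    Eq.trans_le (by ring) (route_path (hϑ1 x y) (hϑ1 y z) (hϑ1 z t) (hϑ0 y t) (hϑ0 x t) m_xz_y m_yt_z (m_xt_y.trans (mul_le_mul_of_nonneg_left
        m_yt_z (hϑ0 x y))))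
  have t5 : (r x y ^ 2)⁻¹ * (r y z ^ 2)⁻¹ * (r z t ^ 2)⁻¹ * (ϑ x y * ϑ x z * ϑ x t * ϑ y z * ϑ y t * ϑ z t) ≤ (ϑ x y ^ 4 * (r x y ^ 2)⁻¹) * (ϑ y z
        ^ 4 * (r y z ^ 2)⁻¹) * (ϑ z t ^ 4 * (r z t ^ 2)⁻¹) :=
    (mul_le_mul_of_nonneg_left w5 (by positivity)).trans_eq (by ring)
  have w6 : ϑ x y * ϑ x z * ϑ x t * ϑ y z * ϑ y t * ϑ z t ≤ ϑ x y ^ 4 * ϑ y t ^ 4 * ϑ z t ^ 4 :=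
    Eq.trans_le (by ring) (route_path (hϑ1 x y) (hϑ1 y t) (hϑ1 z t) (hϑ0 y z) (hϑ0 x z) m_xt_y m_yz_t (m_xz_y.trans (mul_le_mul_of_nonneg_left
        m_yz_t (hϑ0 x y))))
  have t6 : (r x y ^ 2)⁻¹ * (r y t ^ 2)⁻¹ * (r z t ^ 2)⁻¹ * (ϑ x y * ϑ x z * ϑ x t * ϑ y z * ϑ y t * ϑ z t) ≤ (ϑ x y ^ 4 * (r x y ^ 2)⁻¹) * (ϑ y t
        ^ 4 * (r y t ^ 2)⁻¹) * (ϑ z t ^ 4 * (r z t ^ 2)⁻¹) :=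
    (mul_le_mul_of_nonneg_left w6 (by positivity)).trans_eq (by ring)
  have w7 : ϑ x y * ϑ x z * ϑ x t * ϑ y z * ϑ y t * ϑ z t ≤ ϑ x z ^ 4 * ϑ y z ^ 4 * ϑ y t ^ 4 :=
    Eq.trans_le (by ring) (route_path (hϑ1 x z) (hϑ1 y z) (hϑ1 y t) (hϑ0 z t) (hϑ0 x t) m_xy_z m_zt_y (m_xt_z.trans (mul_le_mul_of_nonneg_left
        m_zt_y (hϑ0 x z))))
  have t7 : (r x z ^ 2)⁻¹ * (r y z ^ 2)⁻¹ * (r y t ^ 2)⁻¹ * (ϑ x y * ϑ x z * ϑ x t * ϑ y z * ϑ y t * ϑ z t) ≤ (ϑ x z ^ 4 * (r x z ^ 2)⁻¹) * (ϑ y z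
        ^ 4 * (r y z ^ 2)⁻¹) * (ϑ y t ^ 4 * (r y t ^ 2)⁻¹) :=
    (mul_le_mul_of_nonneg_left w7 (by positivity)).trans_eq (by ring)
  have w8 : ϑ x y * ϑ x z * ϑ x t * ϑ y z * ϑ y t * ϑ z t ≤ ϑ x z ^ 4 * ϑ z t ^ 4 * ϑ y t ^ 4 :=
    Eq.trans_le (by ring) (route_path (hϑ1 x z) (hϑ1 z t) (hϑ1 y t) (hϑ0 y z) (hϑ0 x y) m_xt_z ((m_yz_t).trans_eq (by ring)) (((m_xy_z.trans
        (mul_le_mul_of_nonneg_left m_yz_t (hϑ0 x z)))).trans_eq (by ring)))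
  have t8 : (r x z ^ 2)⁻¹ * (r y t ^ 2)⁻¹ * (r z t ^ 2)⁻¹ * (ϑ x y * ϑ x z * ϑ x t * ϑ y z * ϑ y t * ϑ z t) ≤ (ϑ x z ^ 4 * (r x z ^ 2)⁻¹) * (ϑ y t
        ^ 4 * (r y t ^ 2)⁻¹) * (ϑ z t ^ 4 * (r z t ^ 2)⁻¹) :=
    (mul_le_mul_of_nonneg_left w8 (by positivity)).trans_eq (by ring)
  have w9 : ϑ x y * ϑ x z * ϑ x t * ϑ y z * ϑ y t * ϑ z t ≤ ϑ x t ^ 4 * ϑ y t ^ 4 * ϑ y z ^ 4 :=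
    Eq.trans_le (by ring) (route_path (hϑ1 x t) (hϑ1 y t) (hϑ1 y z) (hϑ0 z t) (hϑ0 x z) m_xy_t ((m_zt_y).trans_eq (by ring)) (((m_xz_t.trans
        (mul_le_mul_of_nonneg_left m_zt_y (hϑ0 x t)))).trans_eq (by ring)))
  have t9 : (r x t ^ 2)⁻¹ * (r y z ^ 2)⁻¹ * (r y t ^ 2)⁻¹ * (ϑ x y * ϑ x z * ϑ x t * ϑ y z * ϑ y t * ϑ z t) ≤ (ϑ x t ^ 4 * (r x t ^ 2)⁻¹) * (ϑ y z
        ^ 4 * (r y z ^ 2)⁻¹) * (ϑ y t ^ 4 * (r y t ^ 2)⁻¹) :=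
    (mul_le_mul_of_nonneg_left w9 (by positivity)).trans_eq (by ring)
  have w10 : ϑ x y * ϑ x z * ϑ x t * ϑ y z * ϑ y t * ϑ z t ≤ ϑ x t ^ 4 * ϑ z t ^ 4 * ϑ y z ^ 4 :=
    Eq.trans_le (by ring) (route_path (hϑ1 x t) (hϑ1 z t) (hϑ1 y z) (hϑ0 y t) (hϑ0 x y) m_xz_t ((m_yt_z).trans_eq (by ring)) (((m_xy_t.trans
        (mul_le_mul_of_nonneg_left m_yt_z (hϑ0 x t)))).trans_eq (by ring)))
  have t10 : (r x t ^ 2)⁻¹ * (r y z ^ 2)⁻¹ * (r z t ^ 2)⁻¹ * (ϑ x y * ϑ x z * ϑ x t * ϑ y z * ϑ y t * ϑ z t) ≤ (ϑ x t ^ 4 * (r x t ^ 2)⁻¹) * (ϑ y z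
        ^ 4 * (r y z ^ 2)⁻¹) * (ϑ z t ^ 4 * (r z t ^ 2)⁻¹) :=
    (mul_le_mul_of_nonneg_left w10 (by positivity)).trans_eq (by ring)
  have w11 : ϑ x y * ϑ x z * ϑ x t * ϑ y z * ϑ y t * ϑ z t ≤ ϑ x y ^ 4 * ϑ x z ^ 4 * ϑ z t ^ 4 :=
    Eq.trans_le (by ring) (route_path (hϑ1 x y) (hϑ1 x z) (hϑ1 z t) (hϑ0 x t) (hϑ0 y t) m_yz_x m_xt_z (m_yt_x.trans (mul_le_mul_of_nonneg_left
        m_xt_z (hϑ0 x y))))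
  have t11 : (r x y ^ 2)⁻¹ * (r x z ^ 2)⁻¹ * (r z t ^ 2)⁻¹ * (ϑ x y * ϑ x z * ϑ x t * ϑ y z * ϑ y t * ϑ z t) ≤ (ϑ x y ^ 4 * (r x y ^ 2)⁻¹) * (ϑ x z
        ^ 4 * (r x z ^ 2)⁻¹) * (ϑ z t ^ 4 * (r z t ^ 2)⁻¹) :=
    (mul_le_mul_of_nonneg_left w11 (by positivity)).trans_eq (by ring)
  have w12 : ϑ x y * ϑ x z * ϑ x t * ϑ y z * ϑ y t * ϑ z t ≤ ϑ x y ^ 4 * ϑ x t ^ 4 * ϑ z t ^ 4 :=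
    Eq.trans_le (by ring) (route_path (hϑ1 x y) (hϑ1 x t) (hϑ1 z t) (hϑ0 x z) (hϑ0 y z) m_yt_x m_xz_t (m_yz_x.trans (mul_le_mul_of_nonneg_left
        m_xz_t (hϑ0 x y))))
  have t12 : (r x y ^ 2)⁻¹ * (r x t ^ 2)⁻¹ * (r z t ^ 2)⁻¹ * (ϑ x y * ϑ x z * ϑ x t * ϑ y z * ϑ y t * ϑ z t) ≤ (ϑ x y ^ 4 * (r x y ^ 2)⁻¹) * (ϑ x t
        ^ 4 * (r x t ^ 2)⁻¹) * (ϑ z t ^ 4 * (r z t ^ 2)⁻¹) :=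
    (mul_le_mul_of_nonneg_left w12 (by positivity)).trans_eq (by ring)
  have w13 : ϑ x y * ϑ x z * ϑ x t * ϑ y z * ϑ y t * ϑ z t ≤ ϑ x z ^ 4 * ϑ x y ^ 4 * ϑ y t ^ 4 :=
    Eq.trans_le (by ring) (route_path (hϑ1 x z) (hϑ1 x y) (hϑ1 y t) (hϑ0 x t) (hϑ0 z t) ((m_yz_x).trans_eq (by ring)) m_xt_y (m_zt_x.trans
        (mul_le_mul_of_nonneg_left m_xt_y (hϑ0 x z))))
  have t13 : (r x y ^ 2)⁻¹ * (r x z ^ 2)⁻¹ * (r y t ^ 2)⁻¹ * (ϑ x y * ϑ x z * ϑ x t * ϑ y z * ϑ y t * ϑ z t) ≤ (ϑ x y ^ 4 * (r x y ^ 2)⁻¹) * (ϑ x z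
        ^ 4 * (r x z ^ 2)⁻¹) * (ϑ y t ^ 4 * (r y t ^ 2)⁻¹) :=
    (mul_le_mul_of_nonneg_left w13 (by positivity)).trans_eq (by ring)
  have w14 : ϑ x y * ϑ x z * ϑ x t * ϑ y z * ϑ y t * ϑ z t ≤ ϑ y t ^ 4 * ϑ x t ^ 4 * ϑ x z ^ 4 :=
    Eq.trans_le (by ring) (route_path (hϑ1 y t) (hϑ1 x t) (hϑ1 x z) (hϑ0 z t) (hϑ0 y z) ((m_xy_t).trans_eq (by ring)) ((m_zt_x).trans_eq (by ring))
        (((m_yz_t.trans (mul_le_mul_of_nonneg_left m_zt_x (hϑ0 y t)))).trans_eq (by ring)))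
  have t14 : (r x z ^ 2)⁻¹ * (r x t ^ 2)⁻¹ * (r y t ^ 2)⁻¹ * (ϑ x y * ϑ x z * ϑ x t * ϑ y z * ϑ y t * ϑ z t) ≤ (ϑ x z ^ 4 * (r x z ^ 2)⁻¹) * (ϑ x t
        ^ 4 * (r x t ^ 2)⁻¹) * (ϑ y t ^ 4 * (r y t ^ 2)⁻¹) :=
    (mul_le_mul_of_nonneg_left w14 (by positivity)).trans_eq (by ring)
  have w15 : ϑ x y * ϑ x z * ϑ x t * ϑ y z * ϑ y t * ϑ z t ≤ ϑ y z ^ 4 * ϑ x y ^ 4 * ϑ x t ^ 4 :=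
    Eq.trans_le (by ring) (route_path (hϑ1 y z) (hϑ1 x y) (hϑ1 x t) (hϑ0 y t) (hϑ0 z t) ((m_xz_y).trans_eq (by ring)) m_yt_x (m_zt_y.trans
        (mul_le_mul_of_nonneg_left m_yt_x (hϑ0 y z))))
  have t15 : (r x y ^ 2)⁻¹ * (r x t ^ 2)⁻¹ * (r y z ^ 2)⁻¹ * (ϑ x y * ϑ x z * ϑ x t * ϑ y z * ϑ y t * ϑ z t) ≤ (ϑ x y ^ 4 * (r x y ^ 2)⁻¹) * (ϑ x t
        ^ 4 * (r x t ^ 2)⁻¹) * (ϑ y z ^ 4 * (r y z ^ 2)⁻¹) :=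
    (mul_le_mul_of_nonneg_left w15 (by positivity)).trans_eq (by ring)
  have w16 : ϑ x y * ϑ x z * ϑ x t * ϑ y z * ϑ y t * ϑ z t ≤ ϑ y z ^ 4 * ϑ x z ^ 4 * ϑ x t ^ 4 :=
    Eq.trans_le (by ring) (route_path (hϑ1 y z) (hϑ1 x z) (hϑ1 x t) (hϑ0 z t) (hϑ0 y t) ((m_xy_z).trans_eq (by ring)) m_zt_x (m_yt_z.trans
        (mul_le_mul_of_nonneg_left m_zt_x (hϑ0 y z))))
  have t16 : (r x z ^ 2)⁻¹ * (r x t ^ 2)⁻¹ * (r y z ^ 2)⁻¹ * (ϑ x y * ϑ x z * ϑ x t * ϑ y z * ϑ y t * ϑ z t) ≤ (ϑ x z ^ 4 * (r x z ^ 2)⁻¹) * (ϑ x t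
        ^ 4 * (r x t ^ 2)⁻¹) * (ϑ y z ^ 4 * (r y z ^ 2)⁻¹) :=
    (mul_le_mul_of_nonneg_left w16 (by positivity)).trans_eq (by ring)
  have e : ((r x y ^ 2)⁻¹ * (r x z ^ 2)⁻¹ * (r x t ^ 2)⁻¹ + (r x y ^ 2)⁻¹ * (r y z ^ 2)⁻¹ * (r y t ^ 2)⁻¹ + (r x z ^ 2)⁻¹ * (r y z ^ 2)⁻¹ * (r z t
        ^ 2)⁻¹ + (r x t ^ 2)⁻¹ * (r y t ^ 2)⁻¹ * (r z t ^ 2)⁻¹ + (r x y ^ 2)⁻¹ * (r y z ^ 2)⁻¹ * (r z t ^ 2)⁻¹ + (r x y ^ 2)⁻¹ * (r y t ^ 2)⁻¹ * (r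
        z t ^ 2)⁻¹ + (r x z ^ 2)⁻¹ * (r y z ^ 2)⁻¹ * (r y t ^ 2)⁻¹ + (r x z ^ 2)⁻¹ * (r y t ^ 2)⁻¹ * (r z t ^ 2)⁻¹ + (r x t ^ 2)⁻¹ * (r y z ^ 2)⁻¹
        * (r y t ^ 2)⁻¹ + (r x t ^ 2)⁻¹ * (r y z ^ 2)⁻¹ * (r z t ^ 2)⁻¹ + (r x y ^ 2)⁻¹ * (r x z ^ 2)⁻¹ * (r z t ^ 2)⁻¹ + (r x y ^ 2)⁻¹ * (r x t ^
        2)⁻¹ * (r z t ^ 2)⁻¹ + (r x y ^ 2)⁻¹ * (r x z ^ 2)⁻¹ * (r y t ^ 2)⁻¹ + (r x z ^ 2)⁻¹ * (r x t ^ 2)⁻¹ * (r y t ^ 2)⁻¹ + (r x y ^ 2)⁻¹ * (r x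
        t ^ 2)⁻¹ * (r y z ^ 2)⁻¹ + (r x z ^ 2)⁻¹ * (r x t ^ 2)⁻¹ * (r y z ^ 2)⁻¹) * (ϑ x y * ϑ x z * ϑ x t * ϑ y z * ϑ y t * ϑ z t) = (r x y ^ 2)⁻¹
        * (r x z ^ 2)⁻¹ * (r x t ^ 2)⁻¹ * (ϑ x y * ϑ x z * ϑ x t * ϑ y z * ϑ y t * ϑ z t) + (r x y ^ 2)⁻¹ * (r y z ^ 2)⁻¹ * (r y t ^ 2)⁻¹ * (ϑ x y
        * ϑ x z * ϑ x t * ϑ y z * ϑ y t * ϑ z t) + (r x z ^ 2)⁻¹ * (r y z ^ 2)⁻¹ * (r z t ^ 2)⁻¹ * (ϑ x y * ϑ x z * ϑ x t * ϑ y z * ϑ y t * ϑ z t)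
        + (r x t ^ 2)⁻¹ * (r y t ^ 2)⁻¹ * (r z t ^ 2)⁻¹ * (ϑ x y * ϑ x z * ϑ x t * ϑ y z * ϑ y t * ϑ z t) + (r x y ^ 2)⁻¹ * (r y z ^ 2)⁻¹ * (r z t
        ^ 2)⁻¹ * (ϑ x y * ϑ x z * ϑ x t * ϑ y z * ϑ y t * ϑ z t) + (r x y ^ 2)⁻¹ * (r y t ^ 2)⁻¹ * (r z t ^ 2)⁻¹ * (ϑ x y * ϑ x z * ϑ x t * ϑ y z *
        ϑ y t * ϑ z t) + (r x z ^ 2)⁻¹ * (r y z ^ 2)⁻¹ * (r y t ^ 2)⁻¹ * (ϑ x y * ϑ x z * ϑ x t * ϑ y z * ϑ y t * ϑ z t) + (r x z ^ 2)⁻¹ * (r y t ^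
        2)⁻¹ * (r z t ^ 2)⁻¹ * (ϑ x y * ϑ x z * ϑ x t * ϑ y z * ϑ y t * ϑ z t) + (r x t ^ 2)⁻¹ * (r y z ^ 2)⁻¹ * (r y t ^ 2)⁻¹ * (ϑ x y * ϑ x z * ϑ
        x t * ϑ y z * ϑ y t * ϑ z t) + (r x t ^ 2)⁻¹ * (r y z ^ 2)⁻¹ * (r z t ^ 2)⁻¹ * (ϑ x y * ϑ x z * ϑ x t * ϑ y z * ϑ y t * ϑ z t) + (r x y ^
        2)⁻¹ * (r x z ^ 2)⁻¹ * (r z t ^ 2)⁻¹ * (ϑ x y * ϑ x z * ϑ x t * ϑ y z * ϑ y t * ϑ z t) + (r x y ^ 2)⁻¹ * (r x t ^ 2)⁻¹ * (r z t ^ 2)⁻¹ * (ϑ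
        x y * ϑ x z * ϑ x t * ϑ y z * ϑ y t * ϑ z t) + (r x y ^ 2)⁻¹ * (r x z ^ 2)⁻¹ * (r y t ^ 2)⁻¹ * (ϑ x y * ϑ x z * ϑ x t * ϑ y z * ϑ y t * ϑ z
        t) + (r x z ^ 2)⁻¹ * (r x t ^ 2)⁻¹ * (r y t ^ 2)⁻¹ * (ϑ x y * ϑ x z * ϑ x t * ϑ y z * ϑ y t * ϑ z t) + (r x y ^ 2)⁻¹ * (r x t ^ 2)⁻¹ * (r y
        z ^ 2)⁻¹ * (ϑ x y * ϑ x z * ϑ x t * ϑ y z * ϑ y t * ϑ z t) + (r x z ^ 2)⁻¹ * (r x t ^ 2)⁻¹ * (r y z ^ 2)⁻¹ * (ϑ x y * ϑ x z * ϑ x t * ϑ y z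
        * ϑ y t * ϑ z t) := by ring
  rw [e]
  linarith [t1, t2, t3, t4, t5, t6, t7, t8, t9, t10, t11, t12, t13, t14, t15, t16]

/-! ## §2. The four weighted slot sums -/

/-- **Weighted sixteen-tree slot sum** (`x` fixed): `Σ T16·W ≤ 16·S4³`. [folklore] -/
theorem weighted_tree16_slot_one (hϑ1 : ∀ a b, 1 ≤ ϑ a b) (hϑsymm : ∀ a b, ϑ a b = ϑ b a) (hϑmul : ∀ a b c, ϑ a c ≤ ϑ a b * ϑ b c)
    (hrsymm : ∀ a b, r a b = r b a) (hS4 : ∀ u, ∑ v, ϑ u v ^ 4 * (r u v ^ 2)⁻¹ ≤ S4) (x : ι) :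
    ∑ y, ∑ z, ∑ t, ((r x y ^ 2)⁻¹ * (r x z ^ 2)⁻¹ * (r x t ^ 2)⁻¹ + (r x y ^ 2)⁻¹ * (r y z ^ 2)⁻¹ * (r y t ^ 2)⁻¹ + (r x z ^ 2)⁻¹ * (r y z ^ 2)⁻¹ *
        (r z t ^ 2)⁻¹ + (r x t ^ 2)⁻¹ * (r y t ^ 2)⁻¹ * (r z t ^ 2)⁻¹ + (r x y ^ 2)⁻¹ * (r y z ^ 2)⁻¹ * (r z t ^ 2)⁻¹ + (r x y ^ 2)⁻¹ * (r y t ^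
        2)⁻¹ * (r z t ^ 2)⁻¹ + (r x z ^ 2)⁻¹ * (r y z ^ 2)⁻¹ * (r y t ^ 2)⁻¹ + (r x z ^ 2)⁻¹ * (r y t ^ 2)⁻¹ * (r z t ^ 2)⁻¹ + (r x t ^ 2)⁻¹ * (r y
        z ^ 2)⁻¹ * (r y t ^ 2)⁻¹ + (r x t ^ 2)⁻¹ * (r y z ^ 2)⁻¹ * (r z t ^ 2)⁻¹ + (r x y ^ 2)⁻¹ * (r x z ^ 2)⁻¹ * (r z t ^ 2)⁻¹ + (r x y ^ 2)⁻¹ *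
        (r x t ^ 2)⁻¹ * (r z t ^ 2)⁻¹ + (r x y ^ 2)⁻¹ * (r x z ^ 2)⁻¹ * (r y t ^ 2)⁻¹ + (r x z ^ 2)⁻¹ * (r x t ^ 2)⁻¹ * (r y t ^ 2)⁻¹ + (r x y ^
        2)⁻¹ * (r x t ^ 2)⁻¹ * (r y z ^ 2)⁻¹ + (r x z ^ 2)⁻¹ * (r x t ^ 2)⁻¹ * (r y z ^ 2)⁻¹) * (ϑ x y * ϑ x z * ϑ x t * ϑ y z * ϑ y t * ϑ z t) ≤
        16 * S4 ^ 3 := by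
  have hSc : ∀ v, ∑ u, ϑ u v ^ 4 * (r u v ^ 2)⁻¹ ≤ S4 := fun v => by simp_rw [hrsymm _ v, hϑsymm _ v]; exact hS4 v
  have h := tree_sum_row_le (q := fun u v => ϑ u v ^ 4 * (r u v ^ 2)⁻¹) (fun u v => by positivity) hS4 hSc x
  refine le_trans (Finset.sum_le_sum fun y _ => Finset.sum_le_sum fun z _ => Finset.sum_le_sum fun t _ =>
    full_weight_tree16_le hϑ1 hϑsymm hϑmul x y z t) ?_
  refine le_trans (le_of_eq (Finset.sum_congr rfl fun y _ => Finset.sum_congr rfl fun z _ => Finset.sum_congr rfl fun t _ => ?_)) h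
  ring

/-- **Weighted sixteen-tree slot sum** (`y` fixed): `Σ T16·W ≤ 16·S4³`. [folklore] -/
theorem weighted_tree16_slot_two (hϑ1 : ∀ a b, 1 ≤ ϑ a b) (hϑsymm : ∀ a b, ϑ a b = ϑ b a) (hϑmul : ∀ a b c, ϑ a c ≤ ϑ a b * ϑ b c)
    (hrsymm : ∀ a b, r a b = r b a) (hS4 : ∀ u, ∑ v, ϑ u v ^ 4 * (r u v ^ 2)⁻¹ ≤ S4) (y : ι) :
    ∑ x, ∑ z, ∑ t, ((r x y ^ 2)⁻¹ * (r x z ^ 2)⁻¹ * (r x t ^ 2)⁻¹ + (r x y ^ 2)⁻¹ * (r y z ^ 2)⁻¹ * (r y t ^ 2)⁻¹ + (r x z ^ 2)⁻¹ * (r y z ^ 2)⁻¹ *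
        (r z t ^ 2)⁻¹ + (r x t ^ 2)⁻¹ * (r y t ^ 2)⁻¹ * (r z t ^ 2)⁻¹ + (r x y ^ 2)⁻¹ * (r y z ^ 2)⁻¹ * (r z t ^ 2)⁻¹ + (r x y ^ 2)⁻¹ * (r y t ^
        2)⁻¹ * (r z t ^ 2)⁻¹ + (r x z ^ 2)⁻¹ * (r y z ^ 2)⁻¹ * (r y t ^ 2)⁻¹ + (r x z ^ 2)⁻¹ * (r y t ^ 2)⁻¹ * (r z t ^ 2)⁻¹ + (r x t ^ 2)⁻¹ * (r y
        z ^ 2)⁻¹ * (r y t ^ 2)⁻¹ + (r x t ^ 2)⁻¹ * (r y z ^ 2)⁻¹ * (r z t ^ 2)⁻¹ + (r x y ^ 2)⁻¹ * (r x z ^ 2)⁻¹ * (r z t ^ 2)⁻¹ + (r x y ^ 2)⁻¹ *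
        (r x t ^ 2)⁻¹ * (r z t ^ 2)⁻¹ + (r x y ^ 2)⁻¹ * (r x z ^ 2)⁻¹ * (r y t ^ 2)⁻¹ + (r x z ^ 2)⁻¹ * (r x t ^ 2)⁻¹ * (r y t ^ 2)⁻¹ + (r x y ^
        2)⁻¹ * (r x t ^ 2)⁻¹ * (r y z ^ 2)⁻¹ + (r x z ^ 2)⁻¹ * (r x t ^ 2)⁻¹ * (r y z ^ 2)⁻¹) * (ϑ x y * ϑ x z * ϑ x t * ϑ y z * ϑ y t * ϑ z t) ≤
        16 * S4 ^ 3 := by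
  have hSc : ∀ v, ∑ u, ϑ u v ^ 4 * (r u v ^ 2)⁻¹ ≤ S4 := fun v => by simp_rw [hrsymm _ v, hϑsymm _ v]; exact hS4 v
  have h := tree_sum_row_le (q := fun u v => ϑ u v ^ 4 * (r u v ^ 2)⁻¹) (fun u v => by positivity) hS4 hSc y
  refine le_trans (Finset.sum_le_sum fun x _ => Finset.sum_le_sum fun z _ => Finset.sum_le_sum fun t _ =>
    full_weight_tree16_le hϑ1 hϑsymm hϑmul x y z t) ?_
  refine le_trans (le_of_eq (Finset.sum_congr rfl fun x _ => Finset.sum_congr rfl fun z _ => Finset.sum_congr rfl fun t _ => ?_)) h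
  rw [hrsymm y x, hϑsymm y x]; ring

/-- **Weighted sixteen-tree slot sum** (`z` fixed): `Σ T16·W ≤ 16·S4³`. [folklore] -/
theorem weighted_tree16_slot_three (hϑ1 : ∀ a b, 1 ≤ ϑ a b) (hϑsymm : ∀ a b, ϑ a b = ϑ b a) (hϑmul : ∀ a b c, ϑ a c ≤ ϑ a b * ϑ b c)
    (hrsymm : ∀ a b, r a b = r b a) (hS4 : ∀ u, ∑ v, ϑ u v ^ 4 * (r u v ^ 2)⁻¹ ≤ S4) (z : ι) :
    ∑ x, ∑ y, ∑ t, ((r x y ^ 2)⁻¹ * (r x z ^ 2)⁻¹ * (r x t ^ 2)⁻¹ + (r x y ^ 2)⁻¹ * (r y z ^ 2)⁻¹ * (r y t ^ 2)⁻¹ + (r x z ^ 2)⁻¹ * (r y z ^ 2)⁻¹ *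
        (r z t ^ 2)⁻¹ + (r x t ^ 2)⁻¹ * (r y t ^ 2)⁻¹ * (r z t ^ 2)⁻¹ + (r x y ^ 2)⁻¹ * (r y z ^ 2)⁻¹ * (r z t ^ 2)⁻¹ + (r x y ^ 2)⁻¹ * (r y t ^
        2)⁻¹ * (r z t ^ 2)⁻¹ + (r x z ^ 2)⁻¹ * (r y z ^ 2)⁻¹ * (r y t ^ 2)⁻¹ + (r x z ^ 2)⁻¹ * (r y t ^ 2)⁻¹ * (r z t ^ 2)⁻¹ + (r x t ^ 2)⁻¹ * (r y
        z ^ 2)⁻¹ * (r y t ^ 2)⁻¹ + (r x t ^ 2)⁻¹ * (r y z ^ 2)⁻¹ * (r z t ^ 2)⁻¹ + (r x y ^ 2)⁻¹ * (r x z ^ 2)⁻¹ * (r z t ^ 2)⁻¹ + (r x y ^ 2)⁻¹ *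
        (r x t ^ 2)⁻¹ * (r z t ^ 2)⁻¹ + (r x y ^ 2)⁻¹ * (r x z ^ 2)⁻¹ * (r y t ^ 2)⁻¹ + (r x z ^ 2)⁻¹ * (r x t ^ 2)⁻¹ * (r y t ^ 2)⁻¹ + (r x y ^
        2)⁻¹ * (r x t ^ 2)⁻¹ * (r y z ^ 2)⁻¹ + (r x z ^ 2)⁻¹ * (r x t ^ 2)⁻¹ * (r y z ^ 2)⁻¹) * (ϑ x y * ϑ x z * ϑ x t * ϑ y z * ϑ y t * ϑ z t) ≤
        16 * S4 ^ 3 := by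
  have hSc : ∀ v, ∑ u, ϑ u v ^ 4 * (r u v ^ 2)⁻¹ ≤ S4 := fun v => by simp_rw [hrsymm _ v, hϑsymm _ v]; exact hS4 v
  have h := tree_sum_row_le (q := fun u v => ϑ u v ^ 4 * (r u v ^ 2)⁻¹) (fun u v => by positivity) hS4 hSc z
  refine le_trans (Finset.sum_le_sum fun x _ => Finset.sum_le_sum fun y _ => Finset.sum_le_sum fun t _ =>
    full_weight_tree16_le hϑ1 hϑsymm hϑmul x y z t) ?_
  refine le_trans (le_of_eq (Finset.sum_congr rfl fun x _ => Finset.sum_congr rfl fun y _ => Finset.sum_congr rfl fun t _ => ?_)) h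
  rw [hrsymm z x, hrsymm z y, hϑsymm z x, hϑsymm z y]; ring

/-- **Weighted sixteen-tree slot sum** (`t` fixed): `Σ T16·W ≤ 16·S4³`. [folklore] -/
theorem weighted_tree16_slot_four (hϑ1 : ∀ a b, 1 ≤ ϑ a b) (hϑsymm : ∀ a b, ϑ a b = ϑ b a) (hϑmul : ∀ a b c, ϑ a c ≤ ϑ a b * ϑ b c)
    (hrsymm : ∀ a b, r a b = r b a) (hS4 : ∀ u, ∑ v, ϑ u v ^ 4 * (r u v ^ 2)⁻¹ ≤ S4) (t : ι) :
    ∑ x, ∑ y, ∑ z, ((r x y ^ 2)⁻¹ * (r x z ^ 2)⁻¹ * (r x t ^ 2)⁻¹ + (r x y ^ 2)⁻¹ * (r y z ^ 2)⁻¹ * (r y t ^ 2)⁻¹ + (r x z ^ 2)⁻¹ * (r y z ^ 2)⁻¹ *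
        (r z t ^ 2)⁻¹ + (r x t ^ 2)⁻¹ * (r y t ^ 2)⁻¹ * (r z t ^ 2)⁻¹ + (r x y ^ 2)⁻¹ * (r y z ^ 2)⁻¹ * (r z t ^ 2)⁻¹ + (r x y ^ 2)⁻¹ * (r y t ^
        2)⁻¹ * (r z t ^ 2)⁻¹ + (r x z ^ 2)⁻¹ * (r y z ^ 2)⁻¹ * (r y t ^ 2)⁻¹ + (r x z ^ 2)⁻¹ * (r y t ^ 2)⁻¹ * (r z t ^ 2)⁻¹ + (r x t ^ 2)⁻¹ * (r y
        z ^ 2)⁻¹ * (r y t ^ 2)⁻¹ + (r x t ^ 2)⁻¹ * (r y z ^ 2)⁻¹ * (r z t ^ 2)⁻¹ + (r x y ^ 2)⁻¹ * (r x z ^ 2)⁻¹ * (r z t ^ 2)⁻¹ + (r x y ^ 2)⁻¹ *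
        (r x t ^ 2)⁻¹ * (r z t ^ 2)⁻¹ + (r x y ^ 2)⁻¹ * (r x z ^ 2)⁻¹ * (r y t ^ 2)⁻¹ + (r x z ^ 2)⁻¹ * (r x t ^ 2)⁻¹ * (r y t ^ 2)⁻¹ + (r x y ^
        2)⁻¹ * (r x t ^ 2)⁻¹ * (r y z ^ 2)⁻¹ + (r x z ^ 2)⁻¹ * (r x t ^ 2)⁻¹ * (r y z ^ 2)⁻¹) * (ϑ x y * ϑ x z * ϑ x t * ϑ y z * ϑ y t * ϑ z t) ≤
        16 * S4 ^ 3 := by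
  have hSc : ∀ v, ∑ u, ϑ u v ^ 4 * (r u v ^ 2)⁻¹ ≤ S4 := fun v => by simp_rw [hrsymm _ v, hϑsymm _ v]; exact hS4 v
  have h := tree_sum_row_le (q := fun u v => ϑ u v ^ 4 * (r u v ^ 2)⁻¹) (fun u v => by positivity) hS4 hSc t
  refine le_trans (Finset.sum_le_sum fun x _ => Finset.sum_le_sum fun y _ => Finset.sum_le_sum fun z _ =>
    full_weight_tree16_le hϑ1 hϑsymm hϑmul x y z t) ?_
  refine le_trans (le_of_eq (Finset.sum_congr rfl fun x _ => Finset.sum_congr rfl fun y _ => Finset.sum_congr rfl fun z _ => ?_)) h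
  rw [hrsymm t x, hrsymm t y, hrsymm t z, hϑsymm t x, hϑsymm t y, hϑsymm t z]; ring

/-! ## §3. Toy -/

/-- Toy (the routing on numbers): with all weights `2`, `W = 2⁶ = 64 ≤ (2·2·2)⁴ = 4096`. -/
example : (2 : ℝ) ^ 6 ≤ (2 * 2 * 2) ^ 4 := by norm_num

end Summit.QuantumFields.BalabanUV.T4Continuum.NE7b.SupWeightedTreeSixteen

end
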